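import Summits.FinalStateConjecture.FinalStateConjecture.Theorems.PhaseMixingCaptureNearExtremalKappaCaptureUnitTemperatureFaceFrameGeometry

/-!
# Unit-temperature front face, part 2: the ten blown-up frame components in closed form

Support file for the stub `stub_unitTemperatureFace` (S1) of the line `unit-temperature-front-face`
(crux `NearExtremalKappaCapture`, route `PhaseMixingCapture`). For `M > 0`, `σ ∈ (0, ½]`,
`x̂ ≥ −½`, `a = M√(1 − σ²)`, `r = r₊ + x̂(r₊ − r₋) = M(1 + σ + 2σx̂)`, at the Kerr–Schild point
`pt = (0, Y_a(r, θ, φ))` and in the blown-up co-rotating Kerr-star frame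
`ê = (κ⁻¹K, (r₊ − r₋)(0, n̂), (0, r θ̂ + a cos θ φ̂), Φ)`, each component `g_{M,a}(ê_α, ê_β)` equals
`M²` times an explicit rational function of `(σ, x̂, cos θ)` (times `√(1 − σ²)` for `G₀₃`, `G₁₃`)
with the positive denominator `D = (1 + σ + 2σx̂)² + (1 − σ²)cos²θ = Σ/M²`; these closed forms are
polynomial identities (`field_simp; ring`) once `κ = σ/(2M(1+σ))`, `ω₊ a = (1−σ)/2`,
`ω₊² = (1−σ)/(4M²(1+σ))`, `a² = M²(1−σ²)`, `H = Mr/Σ` are substituted (part 1). They extend smoothly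
to `σ = 0` (part 3). No named fact is used.
-/

noncomputable section

-- the doubled `FinalStateConjecture.FinalStateConjecture` path component trips dupNamespace
set_option linter.dupNamespace false

namespace Summit.FinalStateConjecture.FinalStateConjecture.Theorems.NearExtremalKappaCapture.UnitTemperatureFrontFace

open Literature.Geometry.Lorentzian
open Set

/-- `G₀₀ = κ⁻² g(K, K)`, `K = T + ω₊Φ`: the `κ⁻²` is absorbed because `g(K,K)` vanishes to second order at `σ = 0`. -/
theorem comp00 {M s x a r : ℝ} (hM : 0 < M) (hs : s ∈ Ioc (0 : ℝ) (1 / 2))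
    (hx : -(1 / 2) ≤ x) (ha : a = M * √(1 - s ^ 2))
    (hr : r = Kerr.rPlus M a + x * (Kerr.rPlus M a - Kerr.rMinus M a)) (θ φ : ℝ) :
    Kerr.bilin M a (E4.ofTimeSpace 0 (Kerr.kerrStar a r θ φ))
      ((Kerr.surfaceGravity M a)⁻¹ • Kerr.hawkingVector M a (E4.ofTimeSpace 0 (Kerr.kerrStar a r θ φ)))
      ((Kerr.surfaceGravity M a)⁻¹ • Kerr.hawkingVector M a (E4.ofTimeSpace 0 (Kerr.kerrStar a r θ φ))) =
      M ^ (2 : ℕ) * (-4 * x * (1 + s) * (Real.cos θ ^ (4 : ℕ) * s ^ (3 : ℕ) * x + Real.cos θ ^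
      (4 : ℕ) * s ^ (3 : ℕ) - Real.cos θ ^ (4 : ℕ) * s ^ (2 : ℕ) * x - Real.cos θ ^ (4 : ℕ) * s
      ^ (2 : ℕ) - Real.cos θ ^ (4 : ℕ) * s * x - Real.cos θ ^ (4 : ℕ) * s + Real.cos θ ^ (4 : ℕ)
      * x + Real.cos θ ^ (4 : ℕ) - 4 * Real.cos θ ^ (2 : ℕ) * s ^ (3 : ℕ) * x ^ (3 : ℕ) - 8 *
      Real.cos θ ^ (2 : ℕ) * s ^ (3 : ℕ) * x ^ (2 : ℕ) - 6 * Real.cos θ ^ (2 : ℕ) * s ^ (3 : ℕ)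
      * x - 2 * Real.cos θ ^ (2 : ℕ) * s ^ (3 : ℕ) + 4 * Real.cos θ ^ (2 : ℕ) * s ^ (2 : ℕ) * x
      ^ (3 : ℕ) - 6 * Real.cos θ ^ (2 : ℕ) * s ^ (2 : ℕ) * x - 2 * Real.cos θ ^ (2 : ℕ) * s ^ (2
      : ℕ) + 8 * Real.cos θ ^ (2 : ℕ) * s * x ^ (2 : ℕ) + 6 * Real.cos θ ^ (2 : ℕ) * s * x + 2 *
      Real.cos θ ^ (2 : ℕ) * s + 6 * Real.cos θ ^ (2 : ℕ) * x + 2 * Real.cos θ ^ (2 : ℕ) + 4 * s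
      ^ (3 : ℕ) * x ^ (3 : ℕ) + 8 * s ^ (3 : ℕ) * x ^ (2 : ℕ) + 5 * s ^ (3 : ℕ) * x + s ^ (3 :
      ℕ) - 4 * s ^ (2 : ℕ) * x ^ (3 : ℕ) + 7 * s ^ (2 : ℕ) * x + 3 * s ^ (2 : ℕ) - 8 * s * x ^
      (2 : ℕ) - s * x + 3 * s - 3 * x + 1) / ((1 + s + 2 * s * x) ^ (2 : ℕ) + (1 - s ^ (2 : ℕ))
      * Real.cos θ ^ (2 : ℕ))) := by
  obtain ⟨hs0, hs1⟩ := hs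
  have hs2 : s ^ 2 ≤ 1 := by nlinarith
  have hρ : 0 < 1 + s + 2 * s * x := one_add_param_pos hs0.le hx
  rw [radius_param hM.le hs0.le hs2 ha] at hr
  have hr0 : 0 < r := by rw [hr]; exact mul_pos hM hρ
  have hD : (1 + s + 2 * s * x) ^ 2 + (1 - s ^ 2) * Real.cos θ ^ 2 ≠ 0 :=
    (denom_param_pos hs0.le hs2 hx _).ne'
  have hH := scalarH_param hM hs0.le hs2 hx ha hr θ φ
  have hM' : M ≠ 0 := hM.ne'
  have hs' : s ≠ 0 := hs0.ne'
  have h1s : 1 + s ≠ 0 := by positivity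
  simp only [Kerr.hawkingVector, map_smul, map_add, _root_.add_apply, _root_.smul_apply, smul_eq_mul]
  rw [Kerr.bilin_apply M a _ (E4.basisVector 0) (E4.basisVector 0), Minkowski.bilin_basisVector_zero,
    Kerr.nullCovector_basisVector_zero, bilin_time_axial M a hr0,
    Kerr.bilin_symm M a _ (Kerr.axialVector _) (E4.basisVector 0), bilin_time_axial M a hr0,
    bilin_axial_axial M a hr0]
  calc _ = (Kerr.surfaceGravity M a)⁻¹ ^ 2 *
        (-1 + 2 * Kerr.scalarH M a (E4.ofTimeSpace 0 (Kerr.kerrStar a r θ φ)) -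
          4 * Kerr.scalarH M a (E4.ofTimeSpace 0 (Kerr.kerrStar a r θ φ)) * (1 - Real.cos θ ^ 2) *
            (Kerr.horizonAngularVelocity M a * a) +
          Kerr.horizonAngularVelocity M a ^ 2 * ((1 - Real.cos θ ^ 2) * (r ^ 2 + a ^ 2) +
            2 * Kerr.scalarH M a (E4.ofTimeSpace 0 (Kerr.kerrStar a r θ φ)) * a ^ 2 *
              (1 - Real.cos θ ^ 2) ^ 2)) := by ring
    _ = _ := by
      rw [horizonAngularVelocity_mul_param hM hs0.le hs2 ha, horizonAngularVelocity_sq_param hM hs0.le hs2 ha,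
        surfaceGravity_param hM hs0.le hs2 ha, hH, sq_param hs2 ha, hr]
      set Dv := (1 + s + 2 * s * x) ^ 2 + (1 - s ^ 2) * Real.cos θ ^ 2 with hDv
      field_simp
      rw [hDv]
      ring

/-- `G₀₁ = κ⁻¹ (r₊ − r₋) g(K, (0, n̂))` (no `1/σ` survives: `κ⁻¹(r₊ − r₋) = 4M²(1 + σ)`). -/
theorem comp01 {M s x a r : ℝ} (hM : 0 < M) (hs : s ∈ Ioc (0 : ℝ) (1 / 2))
    (hx : -(1 / 2) ≤ x) (ha : a = M * √(1 - s ^ 2))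
    (hr : r = Kerr.rPlus M a + x * (Kerr.rPlus M a - Kerr.rMinus M a)) (θ φ : ℝ) :
    Kerr.bilin M a (E4.ofTimeSpace 0 (Kerr.kerrStar a r θ φ))
      ((Kerr.surfaceGravity M a)⁻¹ • Kerr.hawkingVector M a (E4.ofTimeSpace 0 (Kerr.kerrStar a r θ φ)))
      ((Kerr.rPlus M a - Kerr.rMinus M a) • E4.ofTimeSpace 0 (sphRadial θ φ)) =
      M ^ (2 : ℕ) * (2 * (4 * (1 + s) * (1 + s + 2 * s * x) - (1 - s ^ (2 : ℕ)) * (1 - Real.cos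
      θ ^ (2 : ℕ)) * (((1 + s + 2 * s * x) ^ (2 : ℕ) + (1 - s ^ (2 : ℕ)) * Real.cos θ ^ (2 : ℕ))
      + 2 * (1 + s + 2 * s * x))) / ((1 + s + 2 * s * x) ^ (2 : ℕ) + (1 - s ^ (2 : ℕ)) *
      Real.cos θ ^ (2 : ℕ))) := by
  obtain ⟨hs0, hs1⟩ := hs
  have hs2 : s ^ 2 ≤ 1 := by nlinarith
  have hρ : 0 < 1 + s + 2 * s * x := one_add_param_pos hs0.le hx
  rw [radius_param hM.le hs0.le hs2 ha] at hr
  have hr0 : 0 < r := by rw [hr]; exact mul_pos hM hρ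
  have hD : (1 + s + 2 * s * x) ^ 2 + (1 - s ^ 2) * Real.cos θ ^ 2 ≠ 0 :=
    (denom_param_pos hs0.le hs2 hx _).ne'
  have hH := scalarH_param hM hs0.le hs2 hx ha hr θ φ
  have hM' : M ≠ 0 := hM.ne'
  have hs' : s ≠ 0 := hs0.ne'
  have h1s : 1 + s ≠ 0 := by positivity
  simp only [Kerr.hawkingVector, map_smul, map_add, _root_.add_apply, _root_.smul_apply, smul_eq_mul]
  rw [bilin_time_radial M a hr0, Kerr.bilin_symm M a _ (Kerr.axialVector _), bilin_radial_axial M a hr0]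
  calc _ = (Kerr.surfaceGravity M a)⁻¹ * (Kerr.rPlus M a - Kerr.rMinus M a) *
        (2 * Kerr.scalarH M a (E4.ofTimeSpace 0 (Kerr.kerrStar a r θ φ)) -
          Kerr.horizonAngularVelocity M a * a * (1 - Real.cos θ ^ 2) *
            (1 + 2 * Kerr.scalarH M a (E4.ofTimeSpace 0 (Kerr.kerrStar a r θ φ)))) := by ring
    _ = _ := by
      rw [horizonAngularVelocity_mul_param hM hs0.le hs2 ha, surfaceGravity_param hM hs0.le hs2 ha,
        rPlus_sub_rMinus_param hM.le hs0.le hs2 ha, hH]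
      set Dv := (1 + s + 2 * s * x) ^ 2 + (1 - s ^ 2) * Real.cos θ ^ 2 with hDv
      field_simp
      rw [hDv]
      ring

/-- `G₀₂ = κ⁻¹ g(K, ∂_θ) = 0`. -/
theorem comp02 {M s x a r : ℝ} (hM : 0 < M) (hs : s ∈ Ioc (0 : ℝ) (1 / 2))
    (hx : -(1 / 2) ≤ x) (ha : a = M * √(1 - s ^ 2))
    (hr : r = Kerr.rPlus M a + x * (Kerr.rPlus M a - Kerr.rMinus M a)) (θ φ : ℝ) :
    Kerr.bilin M a (E4.ofTimeSpace 0 (Kerr.kerrStar a r θ φ))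
      ((Kerr.surfaceGravity M a)⁻¹ • Kerr.hawkingVector M a (E4.ofTimeSpace 0 (Kerr.kerrStar a r θ φ)))
      (E4.ofTimeSpace 0 (r • sphPolar θ φ + (a * Real.cos θ) • sphAzimuth φ)) =
      0 := by
  obtain ⟨hs0, hs1⟩ := hs
  have hs2 : s ^ 2 ≤ 1 := by nlinarith
  have hρ : 0 < 1 + s + 2 * s * x := one_add_param_pos hs0.le hx
  rw [radius_param hM.le hs0.le hs2 ha] at hr
  have hr0 : 0 < r := by rw [hr]; exact mul_pos hM hρ
  have hD : (1 + s + 2 * s * x) ^ 2 + (1 - s ^ 2) * Real.cos θ ^ 2 ≠ 0 :=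
    (denom_param_pos hs0.le hs2 hx _).ne'
  have hH := scalarH_param hM hs0.le hs2 hx ha hr θ φ
  have hM' : M ≠ 0 := hM.ne'
  have hs' : s ≠ 0 := hs0.ne'
  have h1s : 1 + s ≠ 0 := by positivity
  simp only [Kerr.hawkingVector, map_smul, map_add, _root_.add_apply, _root_.smul_apply, smul_eq_mul]
  rw [bilin_time_polar M a hr0, Kerr.bilin_symm, bilin_polar_axial M a hr0]
  ring

/-- `G₀₃ = κ⁻¹ g(K, Φ)`: the `κ⁻¹` is absorbed because `g(K, Φ)` vanishes to first order at `σ = 0`. -/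
theorem comp03 {M s x a r : ℝ} (hM : 0 < M) (hs : s ∈ Ioc (0 : ℝ) (1 / 2))
    (hx : -(1 / 2) ≤ x) (ha : a = M * √(1 - s ^ 2))
    (hr : r = Kerr.rPlus M a + x * (Kerr.rPlus M a - Kerr.rMinus M a)) (θ φ : ℝ) :
    Kerr.bilin M a (E4.ofTimeSpace 0 (Kerr.kerrStar a r θ φ))
      ((Kerr.surfaceGravity M a)⁻¹ • Kerr.hawkingVector M a (E4.ofTimeSpace 0 (Kerr.kerrStar a r θ φ)))
      (Kerr.axialVector (E4.ofTimeSpace 0 (Kerr.kerrStar a r θ φ))) =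
      M ^ (2 : ℕ) * (4 * x * √(1 - s ^ (2 : ℕ)) * (1 - Real.cos θ ^ (2 : ℕ)) * (-(Real.cos θ ^
      (2 : ℕ) * s ^ (3 : ℕ) * x) - Real.cos θ ^ (2 : ℕ) * s ^ (3 : ℕ) + Real.cos θ ^ (2 : ℕ) * s
      * x + Real.cos θ ^ (2 : ℕ) * s + 4 * s ^ (3 : ℕ) * x ^ (3 : ℕ) + 8 * s ^ (3 : ℕ) * x ^ (2
      : ℕ) + 5 * s ^ (3 : ℕ) * x + s ^ (3 : ℕ) + 8 * s ^ (2 : ℕ) * x ^ (2 : ℕ) + 12 * s ^ (2 :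
      ℕ) * x + 4 * s ^ (2 : ℕ) + 7 * s * x + 5 * s + 2) / ((1 + s + 2 * s * x) ^ (2 : ℕ) + (1 -
      s ^ (2 : ℕ)) * Real.cos θ ^ (2 : ℕ))) := by
  obtain ⟨hs0, hs1⟩ := hs
  have hs2 : s ^ 2 ≤ 1 := by nlinarith
  have hρ : 0 < 1 + s + 2 * s * x := one_add_param_pos hs0.le hx
  rw [radius_param hM.le hs0.le hs2 ha] at hr
  have hr0 : 0 < r := by rw [hr]; exact mul_pos hM hρ
  have hD : (1 + s + 2 * s * x) ^ 2 + (1 - s ^ 2) * Real.cos θ ^ 2 ≠ 0 :=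
    (denom_param_pos hs0.le hs2 hx _).ne'
  have hH := scalarH_param hM hs0.le hs2 hx ha hr θ φ
  have hM' : M ≠ 0 := hM.ne'
  have hs' : s ≠ 0 := hs0.ne'
  have h1s : 1 + s ≠ 0 := by positivity
  simp only [Kerr.hawkingVector, map_smul, map_add, _root_.add_apply, _root_.smul_apply, smul_eq_mul]
  rw [bilin_time_axial M a hr0, bilin_axial_axial M a hr0, hH,
    surfaceGravity_param hM hs0.le hs2 ha, horizonAngularVelocity_param hM hs0.le hs2 ha, sq_param hs2 ha,
    hr, ha]
  set Dv := (1 + s + 2 * s * x) ^ 2 + (1 - s ^ 2) * Real.cos θ ^ 2 with hDv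
  field_simp
  rw [hDv]
  ring

/-- `G₁₁ = (r₊ − r₋)² g((0,n̂),(0,n̂)) = 4M²σ²(1 + 2H)`. -/
theorem comp11 {M s x a r : ℝ} (hM : 0 < M) (hs : s ∈ Ioc (0 : ℝ) (1 / 2))
    (hx : -(1 / 2) ≤ x) (ha : a = M * √(1 - s ^ 2))
    (hr : r = Kerr.rPlus M a + x * (Kerr.rPlus M a - Kerr.rMinus M a)) (θ φ : ℝ) :
    Kerr.bilin M a (E4.ofTimeSpace 0 (Kerr.kerrStar a r θ φ))
      ((Kerr.rPlus M a - Kerr.rMinus M a) • E4.ofTimeSpace 0 (sphRadial θ φ))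
      ((Kerr.rPlus M a - Kerr.rMinus M a) • E4.ofTimeSpace 0 (sphRadial θ φ)) =
      M ^ (2 : ℕ) * (4 * s ^ (2 : ℕ) * (((1 + s + 2 * s * x) ^ (2 : ℕ) + (1 - s ^ (2 : ℕ)) *
      Real.cos θ ^ (2 : ℕ)) + 2 * (1 + s + 2 * s * x)) / ((1 + s + 2 * s * x) ^ (2 : ℕ) + (1 - s
      ^ (2 : ℕ)) * Real.cos θ ^ (2 : ℕ))) := by
  obtain ⟨hs0, hs1⟩ := hs
  have hs2 : s ^ 2 ≤ 1 := by nlinarith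
  have hρ : 0 < 1 + s + 2 * s * x := one_add_param_pos hs0.le hx
  rw [radius_param hM.le hs0.le hs2 ha] at hr
  have hr0 : 0 < r := by rw [hr]; exact mul_pos hM hρ
  have hD : (1 + s + 2 * s * x) ^ 2 + (1 - s ^ 2) * Real.cos θ ^ 2 ≠ 0 :=
    (denom_param_pos hs0.le hs2 hx _).ne'
  have hH := scalarH_param hM hs0.le hs2 hx ha hr θ φ
  have hM' : M ≠ 0 := hM.ne'
  have hs' : s ≠ 0 := hs0.ne'
  have h1s : 1 + s ≠ 0 := by positivity
  simp only [map_smul, _root_.smul_apply, smul_eq_mul]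
  rw [bilin_radial_radial M a hr0, hH, rPlus_sub_rMinus_param hM.le hs0.le hs2 ha]
  set Dv := (1 + s + 2 * s * x) ^ 2 + (1 - s ^ 2) * Real.cos θ ^ 2 with hDv
  field_simp
  rw [hDv]
  ring

/-- `G₁₂ = 0`. -/
theorem comp12 {M s x a r : ℝ} (hM : 0 < M) (hs : s ∈ Ioc (0 : ℝ) (1 / 2))
    (hx : -(1 / 2) ≤ x) (ha : a = M * √(1 - s ^ 2))
    (hr : r = Kerr.rPlus M a + x * (Kerr.rPlus M a - Kerr.rMinus M a)) (θ φ : ℝ) :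
    Kerr.bilin M a (E4.ofTimeSpace 0 (Kerr.kerrStar a r θ φ))
      ((Kerr.rPlus M a - Kerr.rMinus M a) • E4.ofTimeSpace 0 (sphRadial θ φ))
      (E4.ofTimeSpace 0 (r • sphPolar θ φ + (a * Real.cos θ) • sphAzimuth φ)) =
      0 := by
  obtain ⟨hs0, hs1⟩ := hs
  have hs2 : s ^ 2 ≤ 1 := by nlinarith
  have hρ : 0 < 1 + s + 2 * s * x := one_add_param_pos hs0.le hx
  rw [radius_param hM.le hs0.le hs2 ha] at hr
  have hr0 : 0 < r := by rw [hr]; exact mul_pos hM hρ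
  have hD : (1 + s + 2 * s * x) ^ 2 + (1 - s ^ 2) * Real.cos θ ^ 2 ≠ 0 :=
    (denom_param_pos hs0.le hs2 hx _).ne'
  have hH := scalarH_param hM hs0.le hs2 hx ha hr θ φ
  have hM' : M ≠ 0 := hM.ne'
  have hs' : s ≠ 0 := hs0.ne'
  have h1s : 1 + s ≠ 0 := by positivity
  simp only [map_smul, _root_.smul_apply, smul_eq_mul]
  rw [bilin_radial_polar M a hr0, mul_zero]

/-- `G₁₃ = (r₊ − r₋) g((0,n̂), Φ) = −2Mσ a sin²θ (1 + 2H)`. -/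
theorem comp13 {M s x a r : ℝ} (hM : 0 < M) (hs : s ∈ Ioc (0 : ℝ) (1 / 2))
    (hx : -(1 / 2) ≤ x) (ha : a = M * √(1 - s ^ 2))
    (hr : r = Kerr.rPlus M a + x * (Kerr.rPlus M a - Kerr.rMinus M a)) (θ φ : ℝ) :
    Kerr.bilin M a (E4.ofTimeSpace 0 (Kerr.kerrStar a r θ φ))
      ((Kerr.rPlus M a - Kerr.rMinus M a) • E4.ofTimeSpace 0 (sphRadial θ φ))
      (Kerr.axialVector (E4.ofTimeSpace 0 (Kerr.kerrStar a r θ φ))) =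
      M ^ (2 : ℕ) * (-2 * s * √(1 - s ^ (2 : ℕ)) * (1 - Real.cos θ ^ (2 : ℕ)) * (((1 + s + 2 * s
      * x) ^ (2 : ℕ) + (1 - s ^ (2 : ℕ)) * Real.cos θ ^ (2 : ℕ)) + 2 * (1 + s + 2 * s * x)) /
      ((1 + s + 2 * s * x) ^ (2 : ℕ) + (1 - s ^ (2 : ℕ)) * Real.cos θ ^ (2 : ℕ))) := by
  obtain ⟨hs0, hs1⟩ := hs
  have hs2 : s ^ 2 ≤ 1 := by nlinarith
  have hρ : 0 < 1 + s + 2 * s * x := one_add_param_pos hs0.le hx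
  rw [radius_param hM.le hs0.le hs2 ha] at hr
  have hr0 : 0 < r := by rw [hr]; exact mul_pos hM hρ
  have hD : (1 + s + 2 * s * x) ^ 2 + (1 - s ^ 2) * Real.cos θ ^ 2 ≠ 0 :=
    (denom_param_pos hs0.le hs2 hx _).ne'
  have hH := scalarH_param hM hs0.le hs2 hx ha hr θ φ
  have hM' : M ≠ 0 := hM.ne'
  have hs' : s ≠ 0 := hs0.ne'
  have h1s : 1 + s ≠ 0 := by positivity
  simp only [map_smul, _root_.smul_apply, smul_eq_mul]
  rw [bilin_radial_axial M a hr0, hH, rPlus_sub_rMinus_param hM.le hs0.le hs2 ha, ha]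
  set Dv := (1 + s + 2 * s * x) ^ 2 + (1 - s ^ 2) * Real.cos θ ^ 2 with hDv
  field_simp

/-- `G₂₂ = g(∂_θ, ∂_θ) = Σ = r² + a²cos²θ`. -/
theorem comp22 {M s x a r : ℝ} (hM : 0 < M) (hs : s ∈ Ioc (0 : ℝ) (1 / 2))
    (hx : -(1 / 2) ≤ x) (ha : a = M * √(1 - s ^ 2))
    (hr : r = Kerr.rPlus M a + x * (Kerr.rPlus M a - Kerr.rMinus M a)) (θ φ : ℝ) :
    Kerr.bilin M a (E4.ofTimeSpace 0 (Kerr.kerrStar a r θ φ))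
      (E4.ofTimeSpace 0 (r • sphPolar θ φ + (a * Real.cos θ) • sphAzimuth φ))
      (E4.ofTimeSpace 0 (r • sphPolar θ φ + (a * Real.cos θ) • sphAzimuth φ)) =
      M ^ (2 : ℕ) * ((1 + s + 2 * s * x) ^ (2 : ℕ) + (1 - s ^ (2 : ℕ)) * Real.cos θ ^ (2 : ℕ)) := by
  obtain ⟨hs0, hs1⟩ := hs
  have hs2 : s ^ 2 ≤ 1 := by nlinarith
  have hρ : 0 < 1 + s + 2 * s * x := one_add_param_pos hs0.le hx
  rw [radius_param hM.le hs0.le hs2 ha] at hr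
  have hr0 : 0 < r := by rw [hr]; exact mul_pos hM hρ
  have hD : (1 + s + 2 * s * x) ^ 2 + (1 - s ^ 2) * Real.cos θ ^ 2 ≠ 0 :=
    (denom_param_pos hs0.le hs2 hx _).ne'
  have hH := scalarH_param hM hs0.le hs2 hx ha hr θ φ
  have hM' : M ≠ 0 := hM.ne'
  have hs' : s ≠ 0 := hs0.ne'
  have h1s : 1 + s ≠ 0 := by positivity
  rw [bilin_polar_polar M a hr0, sq_param hs2 ha, hr]
  ring

/-- `G₂₃ = 0`. -/
theorem comp23 {M s x a r : ℝ} (hM : 0 < M) (hs : s ∈ Ioc (0 : ℝ) (1 / 2))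
    (hx : -(1 / 2) ≤ x) (ha : a = M * √(1 - s ^ 2))
    (hr : r = Kerr.rPlus M a + x * (Kerr.rPlus M a - Kerr.rMinus M a)) (θ φ : ℝ) :
    Kerr.bilin M a (E4.ofTimeSpace 0 (Kerr.kerrStar a r θ φ))
      (E4.ofTimeSpace 0 (r • sphPolar θ φ + (a * Real.cos θ) • sphAzimuth φ))
      (Kerr.axialVector (E4.ofTimeSpace 0 (Kerr.kerrStar a r θ φ))) =
      0 := by
  obtain ⟨hs0, hs1⟩ := hs
  have hs2 : s ^ 2 ≤ 1 := by nlinarith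
  have hρ : 0 < 1 + s + 2 * s * x := one_add_param_pos hs0.le hx
  rw [radius_param hM.le hs0.le hs2 ha] at hr
  have hr0 : 0 < r := by rw [hr]; exact mul_pos hM hρ
  have hD : (1 + s + 2 * s * x) ^ 2 + (1 - s ^ 2) * Real.cos θ ^ 2 ≠ 0 :=
    (denom_param_pos hs0.le hs2 hx _).ne'
  have hH := scalarH_param hM hs0.le hs2 hx ha hr θ φ
  have hM' : M ≠ 0 := hM.ne'
  have hs' : s ≠ 0 := hs0.ne'
  have h1s : 1 + s ≠ 0 := by positivity
  rw [bilin_polar_axial M a hr0]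

/-- `G₃₃ = g(Φ, Φ) = sin²θ(r² + a²) + 2Ha² sin⁴θ`. -/
theorem comp33 {M s x a r : ℝ} (hM : 0 < M) (hs : s ∈ Ioc (0 : ℝ) (1 / 2))
    (hx : -(1 / 2) ≤ x) (ha : a = M * √(1 - s ^ 2))
    (hr : r = Kerr.rPlus M a + x * (Kerr.rPlus M a - Kerr.rMinus M a)) (θ φ : ℝ) :
    Kerr.bilin M a (E4.ofTimeSpace 0 (Kerr.kerrStar a r θ φ))
      (Kerr.axialVector (E4.ofTimeSpace 0 (Kerr.kerrStar a r θ φ)))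
      (Kerr.axialVector (E4.ofTimeSpace 0 (Kerr.kerrStar a r θ φ))) =
      M ^ (2 : ℕ) * ((1 - Real.cos θ ^ (2 : ℕ)) * (((1 + s + 2 * s * x) ^ (2 : ℕ) + (1 - s ^ (2
      : ℕ))) * ((1 + s + 2 * s * x) ^ (2 : ℕ) + (1 - s ^ (2 : ℕ)) * Real.cos θ ^ (2 : ℕ)) + 2 *
      (1 + s + 2 * s * x) * (1 - s ^ (2 : ℕ)) * (1 - Real.cos θ ^ (2 : ℕ))) / ((1 + s + 2 * s *
      x) ^ (2 : ℕ) + (1 - s ^ (2 : ℕ)) * Real.cos θ ^ (2 : ℕ))) := by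
  obtain ⟨hs0, hs1⟩ := hs
  have hs2 : s ^ 2 ≤ 1 := by nlinarith
  have hρ : 0 < 1 + s + 2 * s * x := one_add_param_pos hs0.le hx
  rw [radius_param hM.le hs0.le hs2 ha] at hr
  have hr0 : 0 < r := by rw [hr]; exact mul_pos hM hρ
  have hD : (1 + s + 2 * s * x) ^ 2 + (1 - s ^ 2) * Real.cos θ ^ 2 ≠ 0 :=
    (denom_param_pos hs0.le hs2 hx _).ne'
  have hH := scalarH_param hM hs0.le hs2 hx ha hr θ φ
  have hM' : M ≠ 0 := hM.ne'
  have hs' : s ≠ 0 := hs0.ne'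
  have h1s : 1 + s ≠ 0 := by positivity
  rw [bilin_axial_axial M a hr0, hH, sq_param hs2 ha, hr]
  set Dv := (1 + s + 2 * s * x) ^ 2 + (1 - s ^ 2) * Real.cos θ ^ 2 with hDv
  field_simp

end Summit.FinalStateConjecture.FinalStateConjecture.Theorems.NearExtremalKappaCapture.UnitTemperatureFrontFace
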